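import Mathlib
import HarnessLib

/-!
# ValiantsHypothesis / LacunarySymmetroid — crux `MatrixDescartes` (stmt-ValiantsHypothesis-18050, V1),
# line «osculation-law», rung O3: the RECTANGLE certificate — osculation floors at EVERY rank from values only (analytic core)

Roster R2664 (b) / R2685 (O3 = val-sym-engine-7; this file engine-7 g6).  The LOWER side of an O3 census row exhibits points of the
osculation set `{Φ = 0, H = 0, t > 0, b > 0}`.  At rank two the sheets `b_ε(t)` are explicit radicals (✓ `osc_rankTwo_card_ge_branch`); at
rank `r ≥ 3` they are not, and the landed rank-three / rank-four LOWER certificates (✓ `osc_rankThreeS_card_ge`, ✓ `osc_rankFourTop_card_ge`)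
need the EXPANDED eliminants `L₁, L₀, R₂` (degrees `35n … 124n`) on every window — the cost wall of engine-7 g5 («interpolation route»).

CONTENT (pure real analysis, no polynomial algebra): the IMPLICIT-BRANCH form of the intermediate value theorem on a rectangle
`[l, u] × [β₁, β₂]`.
* `implicit_root_continuousOn`: `F` jointly continuous on the rectangle, `F(t, ·)` strictly increasing on `[β₁, β₂]` and
  `F(t, β₁) < 0 < F(t, β₂)` for every `t ∈ [l, u]` ⇒ there is a CONTINUOUS root function `φ : [l, u] → [β₁, β₂]`, `F(t, φ t) = 0`,
  and it is the only root in the fibre (`lt_implicit_root` / `implicit_root_lt`). [folklore; the one-dimensional implicit function theorem in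
  its topological form — continuity from strict monotonicity, no derivatives]
* `exists_zero_on_implicit_branch`: if moreover `G` is jointly continuous and `σ·G > 0` at the root over `t = l`, `σ·G < 0` at the root over
  `t = u`, then `F` and `G` have a common zero in the rectangle (IVT for `t ↦ σ·G(t, φ t)`). [folklore]
* `mul_lb_of_nonneg` / `mul_lb_of_nonpos` / `mul_ub_of_nonneg` / `mul_ub_of_nonpos`: corner bounds for a product `x·y`, `x ∈ [lo, hi]`,
  `y ∈ [y₁, y₂] ⊂ [0, ∞)` — the bookkeeping an instance uses to sign `∂_b F` on the rectangle from termwise bounds of the coefficient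
  polynomials. [folklore]
The O3 use (successor files): `F(t, b) = Φ(t, b)` (the insertion polynomial in values, ✓ `eval_Psi3` / `FoldCurve.eval_Psi` / …), `G = H`
in values (✓ `eval_logHessian_Psi3` / `eval_logHessian_Psi` / ✓ `eval_logHessian_sum`); every hypothesis is then a sign condition of a
univariate polynomial with VALUE coefficients on an interval (termwise bounds) — no eliminant is ever expanded, at any rank.

HONEST FRAMING.  Calibration tooling for a line stub; the LAW `stub_osculationLaw`, the crux `MatrixDescartes`, Conjecture B and `VP ≠ VNP`
are OPEN / NOT proved; no summit statement is proved by this file.  No definitions, no named facts; Mathlib only.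
-/

-- `Summit.ValiantsHypothesis.ValiantsHypothesis.…` is the tree's mandated single-conjunct layout (Sub = Summit).
set_option linter.dupNamespace false

noncomputable section

namespace Summit.ValiantsHypothesis.ValiantsHypothesis.Theorems.LacunarySymmetroidMatrixDescartes

open Set Filter Topology

namespace OsculationCensus

/-- **Continuous implicit root.**  `F` jointly continuous on `[l,u] × [β₁,β₂]`, strictly increasing in the second variable, negative on the
bottom edge and positive on the top edge ⇒ a continuous root function `φ` on `[l,u]` with values in `[β₁,β₂]`; every fibre root is `φ t`
(the two order facts). [folklore] -/
theorem implicit_root_continuousOn (F : ℝ → ℝ → ℝ) (l u β₁ β₂ : ℝ) (hβ : β₁ ≤ β₂)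
    (hF : ContinuousOn (fun p : ℝ × ℝ => F p.1 p.2) (Set.Icc l u ×ˢ Set.Icc β₁ β₂))
    (hmono : ∀ t ∈ Set.Icc l u, StrictMonoOn (F t) (Set.Icc β₁ β₂))
    (hbot : ∀ t ∈ Set.Icc l u, F t β₁ < 0) (htop : ∀ t ∈ Set.Icc l u, 0 < F t β₂) :
    ∃ φ : ℝ → ℝ, ContinuousOn φ (Set.Icc l u) ∧ (∀ t ∈ Set.Icc l u, φ t ∈ Set.Icc β₁ β₂ ∧ F t (φ t) = 0) ∧
      (∀ t ∈ Set.Icc l u, ∀ b ∈ Set.Icc β₁ β₂, F t b < 0 → b < φ t) ∧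
      (∀ t ∈ Set.Icc l u, ∀ b ∈ Set.Icc β₁ β₂, 0 < F t b → φ t < b) := by
  classical
  -- slices are continuous
  have hslice : ∀ t ∈ Set.Icc l u, ContinuousOn (F t) (Set.Icc β₁ β₂) := fun t ht =>
    hF.comp (continuousOn_const.prodMk continuousOn_id) (fun b hb => ⟨ht, hb⟩)
  have hcol : ∀ b ∈ Set.Icc β₁ β₂, ContinuousOn (fun t => F t b) (Set.Icc l u) := fun b hb =>
    hF.comp (continuousOn_id.prodMk continuousOn_const) (fun t ht => ⟨ht, hb⟩)
  -- a root in every fibre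
  have hex : ∀ t ∈ Set.Icc l u, ∃ b ∈ Set.Icc β₁ β₂, F t b = 0 := fun t ht => by
    obtain ⟨b, hb, hb0⟩ := intermediate_value_Icc hβ (hslice t ht) ⟨(hbot t ht).le, (htop t ht).le⟩
    exact ⟨b, hb, hb0⟩
  let φ : ℝ → ℝ := fun t => if ht : t ∈ Set.Icc l u then (hex t ht).choose else β₁
  have hφ : ∀ t ∈ Set.Icc l u, φ t ∈ Set.Icc β₁ β₂ ∧ F t (φ t) = 0 := fun t ht => by
    simp only [φ, dif_pos ht]; exact (hex t ht).choose_spec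
  -- order facts (uniqueness of the fibre root)
  have hlt : ∀ t ∈ Set.Icc l u, ∀ b ∈ Set.Icc β₁ β₂, F t b < 0 → b < φ t := by
    intro t ht b hb hFb
    by_contra hle
    push Not at hle
    have h := (hmono t ht).monotoneOn (hφ t ht).1 hb hle
    rw [(hφ t ht).2] at h
    linarith
  have hgt : ∀ t ∈ Set.Icc l u, ∀ b ∈ Set.Icc β₁ β₂, 0 < F t b → φ t < b := by
    intro t ht b hb hFb
    by_contra hle
    push Not at hle
    have h := (hmono t ht).monotoneOn hb (hφ t ht).1 hle
    rw [(hφ t ht).2] at h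
    linarith
  refine ⟨φ, ?_, hφ, hlt, hgt⟩
  -- continuity within `[l,u]`
  intro t₀ ht₀
  rw [ContinuousWithinAt, Metric.tendsto_nhds]
  intro ε hε
  obtain ⟨⟨hb1, hb2⟩, hroot⟩ := hφ t₀ ht₀
  -- lower barrier
  have hlow : ∀ᶠ x in 𝓝[Set.Icc l u] t₀, φ t₀ - ε < φ x := by
    by_cases hcase : β₁ < φ t₀ - ε / 2
    · have hbm : φ t₀ - ε / 2 ∈ Set.Icc β₁ β₂ := ⟨hcase.le, by linarith⟩
      have hneg : F t₀ (φ t₀ - ε / 2) < 0 := by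
        have h := hmono t₀ ht₀ hbm (hφ t₀ ht₀).1 (by linarith : φ t₀ - ε / 2 < φ t₀)
        rwa [hroot] at h
      have hc : ContinuousWithinAt (fun x => F x (φ t₀ - ε / 2)) (Set.Icc l u) t₀ := hcol _ hbm t₀ ht₀
      have hev : ∀ᶠ x in 𝓝[Set.Icc l u] t₀, F x (φ t₀ - ε / 2) < 0 := hc.eventually (Iio_mem_nhds hneg)
      filter_upwards [hev, eventually_mem_nhdsWithin] with x hx hxs
      have h := hlt x hxs _ hbm hx
      linarith
    · push Not at hcase
      filter_upwards [eventually_mem_nhdsWithin] with x hxs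
      have h := (hφ x hxs).1.1
      linarith
  -- upper barrier
  have hhigh : ∀ᶠ x in 𝓝[Set.Icc l u] t₀, φ x < φ t₀ + ε := by
    by_cases hcase : φ t₀ + ε / 2 < β₂
    · have hbp : φ t₀ + ε / 2 ∈ Set.Icc β₁ β₂ := ⟨by linarith, hcase.le⟩
      have hpos : 0 < F t₀ (φ t₀ + ε / 2) := by
        have h := hmono t₀ ht₀ (hφ t₀ ht₀).1 hbp (by linarith : φ t₀ < φ t₀ + ε / 2)
        rwa [hroot] at h
      have hc : ContinuousWithinAt (fun x => F x (φ t₀ + ε / 2)) (Set.Icc l u) t₀ := hcol _ hbp t₀ ht₀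
      have hev : ∀ᶠ x in 𝓝[Set.Icc l u] t₀, 0 < F x (φ t₀ + ε / 2) := hc.eventually (Ioi_mem_nhds hpos)
      filter_upwards [hev, eventually_mem_nhdsWithin] with x hx hxs
      have h := hgt x hxs _ hbp hx
      linarith
    · push Not at hcase
      filter_upwards [eventually_mem_nhdsWithin] with x hxs
      have h := (hφ x hxs).1.2
      linarith
  filter_upwards [hlow, hhigh] with x h1 h2
  rw [Real.dist_eq, abs_sub_lt_iff]
  constructor <;> linarith

/-- **A common zero of `F` and `G` on the implicit branch.**  With `F` as in `implicit_root_continuousOn` and `G` jointly continuous: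
if `σ·G > 0` at every fibre root over `t = l` and `σ·G < 0` at every fibre root over `t = u`, then `F = G = 0` somewhere in the rectangle
(intermediate value theorem for `t ↦ σ·G(t, φ t)`). [folklore] -/
theorem exists_zero_on_implicit_branch (F G : ℝ → ℝ → ℝ) (l u β₁ β₂ σ : ℝ) (hlu : l ≤ u) (hβ : β₁ ≤ β₂)
    (hF : ContinuousOn (fun p : ℝ × ℝ => F p.1 p.2) (Set.Icc l u ×ˢ Set.Icc β₁ β₂))
    (hG : ContinuousOn (fun p : ℝ × ℝ => G p.1 p.2) (Set.Icc l u ×ˢ Set.Icc β₁ β₂))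
    (hmono : ∀ t ∈ Set.Icc l u, StrictMonoOn (F t) (Set.Icc β₁ β₂))
    (hbot : ∀ t ∈ Set.Icc l u, F t β₁ < 0) (htop : ∀ t ∈ Set.Icc l u, 0 < F t β₂)
    (hl : ∀ b ∈ Set.Icc β₁ β₂, F l b = 0 → 0 < σ * G l b) (hu : ∀ b ∈ Set.Icc β₁ β₂, F u b = 0 → σ * G u b < 0) :
    ∃ t ∈ Set.Icc l u, ∃ b ∈ Set.Icc β₁ β₂, F t b = 0 ∧ G t b = 0 := by
  obtain ⟨φ, hφc, hφ, -, -⟩ := implicit_root_continuousOn F l u β₁ β₂ hβ hF hmono hbot htop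
  have hg : ContinuousOn (fun t => σ * G t (φ t)) (Set.Icc l u) :=
    continuousOn_const.mul (hG.comp (continuousOn_id.prodMk hφc) (fun t ht => ⟨ht, (hφ t ht).1⟩))
  have hlm : l ∈ Set.Icc l u := ⟨le_rfl, hlu⟩
  have hum : u ∈ Set.Icc l u := ⟨hlu, le_rfl⟩
  have h1 : 0 < σ * G l (φ l) := hl _ (hφ l hlm).1 (hφ l hlm).2
  have h2 : σ * G u (φ u) < 0 := hu _ (hφ u hum).1 (hφ u hum).2
  obtain ⟨t, ht, ht0⟩ := intermediate_value_Icc' hlu hg ⟨h2.le, h1.le⟩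
  have hσ : σ ≠ 0 := by
    rintro rfl
    simp at h1
  exact ⟨t, ht, φ t, (hφ t ht).1, (hφ t ht).2, (mul_eq_zero.1 ht0).resolve_left hσ⟩

/-! ### Corner bounds for products (instances sign `∂_b F` on a rectangle from termwise coefficient bounds) -/

/-- `0 ≤ lo ≤ x`, `0 ≤ y₁ ≤ y` ⇒ `lo·y₁ ≤ x·y`. [folklore] -/
theorem mul_lb_of_nonneg {x y lo y₁ : ℝ} (hlo : 0 ≤ lo) (hx : lo ≤ x) (hy₁ : 0 ≤ y₁) (hy : y₁ ≤ y) : lo * y₁ ≤ x * y := by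
  nlinarith [mul_le_mul hx hy hy₁ (hlo.trans hx)]

/-- `lo ≤ x`, `lo ≤ 0`, `0 ≤ y ≤ y₂` ⇒ `lo·y₂ ≤ x·y`. [folklore] -/
theorem mul_lb_of_nonpos {x y lo y₂ : ℝ} (hlo : lo ≤ 0) (hx : lo ≤ x) (hy0 : 0 ≤ y) (hy : y ≤ y₂) : lo * y₂ ≤ x * y := by
  nlinarith [mul_nonneg (sub_nonneg.2 hx) hy0, mul_nonpos_of_nonpos_of_nonneg hlo (sub_nonneg.2 hy) |> fun h => h]

/-- `x ≤ hi`, `0 ≤ hi`, `0 ≤ y ≤ y₂` ⇒ `x·y ≤ hi·y₂`. [folklore] -/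
theorem mul_ub_of_nonneg {x y hi y₂ : ℝ} (hhi : 0 ≤ hi) (hx : x ≤ hi) (hy0 : 0 ≤ y) (hy : y ≤ y₂) : x * y ≤ hi * y₂ := by
  nlinarith [mul_nonneg (sub_nonneg.2 hx) hy0, mul_nonneg hhi (sub_nonneg.2 hy)]

/-- `x ≤ hi ≤ 0`, `0 ≤ y₁ ≤ y` ⇒ `x·y ≤ hi·y₁`. [folklore] -/
theorem mul_ub_of_nonpos {x y hi y₁ : ℝ} (hhi : hi ≤ 0) (hx : x ≤ hi) (hy₁ : 0 ≤ y₁) (hy : y₁ ≤ y) : x * y ≤ hi * y₁ := by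
  nlinarith [mul_nonpos_of_nonpos_of_nonneg (hx.trans hhi) (sub_nonneg.2 hy), mul_nonneg (sub_nonneg.2 hx) hy₁ |> fun h => h,
    mul_le_mul_of_nonneg_right hx hy₁]

end OsculationCensus

end Summit.ValiantsHypothesis.ValiantsHypothesis.Theorems.LacunarySymmetroidMatrixDescartes
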